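import Literature.Geometry.Kaehler.PullbackFamilyChart
import Literature.NumberTheory.Transcendental.FormIntegrationParametric
import Literature.AlgebraicGeometry.HodgeTheory.HodgeRiemannDegreeOneProofs
import HarnessLib

/-!
# Variation of period-type integrals `p ↦ ∫_M γ ∧ Ψ_p^* Ξ`

Topic: Hodge theory in families (Griffiths' computation of the derivative of the period map,
Voisin (2002), §10.2.2 proof of Thm. 10.9; Carlson–Müller-Stach–Peters (2017), §5.3). Theorems
only, no new facts.

Let `M` be a compact oriented manifold, `Ψ : P → M → T` a family of maps into a manifold `T`,
jointly smooth on `U × M` for an open `U ∋ t` of the (finite-dimensional real normed) parameter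
space `P`, `Ξ` a smooth complex `(k+1)`-form on `T` and `γ` a smooth **closed** complex `l`-form
on `M`, `l + (k + 1) = dim M`. Then the "period integral"
`G(p) = ∫_M γ ∧ Ψ_p^* Ξ`
is differentiable at `t`, and its derivative in the direction `h` is
`∂_h G(t) = ∫_M γ ∧ Ψ_t^*(ι_{Y_h} dΞ)`, `Y_h(x) = ∂_p Ψ(·, x)(t) h`
(`hasFDerivAt_cintegral_wedge_pullback_family`): by the variation formula
`∂_h Ψ_p^*Ξ = d Ψ_t^*(ι_{Y_h} Ξ) + Ψ_t^*(ι_{Y_h} dΞ)` (`hasFDerivAt_pullback_family`),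
differentiation under `∫_M` (`hasFDerivAt_integral_of_contDiffOn_of_hasFDerivAt`) and Stokes
(`γ` closed, so `γ ∧ dη = ± d(γ ∧ η)` integrates to zero). This is the first half of Griffiths'
proof of the holomorphy of the Hodge bundles (Voisin (2002), proof of Thm. 10.9: the derivative of
`t ↦ ∫ ω_t ∧ β` only involves `ι_Y dΩ` restricted to the fibre); the type-theoretic second half is
in `PeriodIntegralHolomorphic.lean`.

## References

* C. Voisin, *Hodge Theory and Complex Algebraic Geometry I*, CUP (2002), §9.2.2, §10.2.2
  (proof of Thm. 10.9). [VoisinHodgeI2002]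
* J. Carlson, S. Müller-Stach, C. Peters, *Period Mappings and Period Domains*, 2nd ed. (2017),
  §5.3. [CarlsonMullerStachPeters2017]
* J. M. Lee, *Introduction to Smooth Manifolds*, 2nd ed. (2013), Thm. 14.35, Lemma 17.9.
  [LeeSmoothManifolds2013]
-/

noncomputable section

open scoped Manifold ContDiff Topology
open Bundle Set Function Filter Module
open Literature.Geometry.Kaehler Literature.NumberTheory.Transcendental
open Literature.AlgebraicGeometry.Motives

namespace Literature.AlgebraicGeometry.HodgeTheory

-- The identification `TangentSpace I x = E` is an abuse of definitional equality; as in the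
-- tree's form files we let `isDefEq` unfold it.
set_option backward.isDefEq.respectTransparency false

variable {EM : Type*} [NormedAddCommGroup EM] [NormedSpace ℂ EM] [FiniteDimensional ℂ EM]
  [MeasurableSpace EM] [BorelSpace EM] {N : ℕ} [Fact (finrank ℝ EM = N)]
  {M : Type*} [TopologicalSpace M] [ChartedSpace EM M] [IsManifold 𝓘(ℝ, EM) ∞ M]
  [T2Space M] [CompactSpace M]
  {o : (x : M) → Orientation ℝ (TangentSpace 𝓘(ℝ, EM) x) (Fin N)}
  {ET : Type*} [NormedAddCommGroup ET] [NormedSpace ℝ ET]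
  {HT : Type*} [TopologicalSpace HT] {IT : ModelWithCorners ℝ ET HT}
  {T : Type*} [TopologicalSpace T] [ChartedSpace HT T] [IsManifold IT ∞ T]
  {P : Type*} [NormedAddCommGroup P] [NormedSpace ℝ P] [FiniteDimensional ℝ P]

/-! ### Stokes: `∫_M γ ∧ dη = 0` for closed `γ` -/

omit [FiniteDimensional ℂ EM] [MeasurableSpace EM] [BorelSpace EM] [Fact (finrank ℝ EM = N)]
  [IsManifold 𝓘(ℝ, EM) ∞ M] [T2Space M] [CompactSpace M] in
/-- For a smooth closed `l`-form `γ` and a smooth `k`-form `η`, `γ ∧ dη = (-1)^l d(γ ∧ η)`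
(Leibniz rule with `dγ = 0`). [cite: WarnerGTM94, Thm. 2.20(2)] -/
theorem wedge_mextDeriv_eq_smul_mextDeriv_wedge {k l : ℕ} {γ : MForm 𝓘(ℝ, EM) M ℂ l}
    (hγ : IsSmoothForm γ) (hγc : IsClosedForm γ) {η : MForm 𝓘(ℝ, EM) M ℂ k}
    (hη : IsSmoothForm η) :
    γ.wedge (mextDeriv η) = ((-1 : ℝ) ^ l) • mextDeriv (γ.wedge η) := by
  haveI : WedgeFacts 𝓘(ℝ, EM) M ℂ := wedgeFacts_discharged _ _ ℂ
  have h := mextDeriv_wedge (I := 𝓘(ℝ, EM)) (M := M) (A := ℂ) hγ hη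
  rw [show mextDeriv γ = 0 from hγc, MForm.zero_wedge, MForm.castDeg_zero, zero_add] at h
  rw [h, smul_smul, ← pow_add, ← two_mul, pow_mul, neg_one_sq, one_pow, one_smul]

omit [FiniteDimensional ℂ EM] [MeasurableSpace EM] [BorelSpace EM] [Fact (finrank ℝ EM = N)]
  [IsManifold 𝓘(ℝ, EM) ∞ M] [T2Space M] [CompactSpace M] in
/-- For a smooth closed `γ` and a smooth `η`, `γ ∧ dη` is an exact smooth form. [folklore] -/
theorem wedge_mextDeriv_mem_cexactSmoothForms {k l : ℕ} {γ : MForm 𝓘(ℝ, EM) M ℂ l}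
    (hγ : IsSmoothForm γ) (hγc : IsClosedForm γ) {η : MForm 𝓘(ℝ, EM) M ℂ k}
    (hη : IsSmoothForm η) :
    γ.wedge (mextDeriv η) ∈ cexactSmoothForms EM M (l + k + 1) := by
  haveI : WedgeFacts 𝓘(ℝ, EM) M ℂ := wedgeFacts_discharged _ _ ℂ
  rw [wedge_mextDeriv_eq_smul_mextDeriv_wedge hγ hγc hη, ← Complex.coe_smul]
  exact Submodule.smul_mem _ _ (Submodule.subset_span
    ⟨γ.wedge η, mem_csmoothForms (isSmoothForm_wedge hγ hη), rfl⟩)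

/-- **Stokes for period integrands**: on a compact oriented manifold without boundary,
`∫_M γ ∧ dη = 0` for a smooth closed `γ` and a smooth `η` of complementary degrees.
[cite: WarnerGTM94, Thm. 4.9] -/
theorem cintegral_wedge_mextDeriv_eq_zero (ho : IsContinuousOrientation o) {k l : ℕ}
    (hkl : l + (k + 1) = N) {γ : MForm 𝓘(ℝ, EM) M ℂ l} (hγ : IsSmoothForm γ)
    (hγc : IsClosedForm γ) {η : MForm 𝓘(ℝ, EM) M ℂ k} (hη : IsSmoothForm η) :
    cintegral o ((γ.wedge (mextDeriv η)).castDeg hkl) = 0 := by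
  subst hkl
  exact HodgeRiemannDegreeOne.cintegral_eq_zero_of_mem_cexactSmoothForms o ho
    (wedge_mextDeriv_mem_cexactSmoothForms hγ hγc hη)

/-! ### The derivative of `p ↦ ∫_M γ ∧ Ψ_p^* Ξ` -/

/-- **Variation of a period-type integral.** Let `Ψ : P → M → T` be jointly smooth on `U × M`
(`U ∋ t` open), `Ξ` a smooth complex `(k+1)`-form on `T`, `γ` a smooth closed complex `l`-form on
the compact oriented `M` (`l + (k + 1) = dim M`, continuous orientation family `o`). Then
`G(p) = ∫_M γ ∧ Ψ_p^*Ξ` has a (real) derivative `G'` at `t` with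
`G' h = ∫_M γ ∧ Ψ_t^*(ι_{Y_h} dΞ)`, `Y_h(x) = ∂_p Ψ(·, x)(t) h`, the contraction
`Ψ_t^*(ι_Y dΞ)(x) = (dΞ (Ψ t x))(Y x, dΨ_t ·, …, dΨ_t ·)` (the exact part
`∫ γ ∧ dΨ_t^*(ι_Y Ξ)` of the variation formula vanishes by Stokes). Voisin (2002), §10.2.2,
proof of Thm. 10.9 (the computation of `∂/∂t ∫ ω_t ∧ β`); Carlson–Müller-Stach–Peters (2017),
§5.3. [cite: VoisinHodgeI2002, §10.2.2 (proof of Thm. 10.9)] -/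
theorem hasFDerivAt_cintegral_wedge_pullback_family (ho : IsContinuousOrientation o)
    [IT.Boundaryless] {Ψ : P → M → T} {U : Set P} (hU : IsOpen U) {t : P} (ht : t ∈ U)
    (hΨ : ∀ p ∈ U, ∀ x, ContMDiffAt (𝓘(ℝ, P).prod 𝓘(ℝ, EM)) IT ∞ (uncurry Ψ) (p, x))
    {k l : ℕ} (hkl : l + (k + 1) = N) {Ξ : MForm IT T ℂ (k + 1)} (hΞ : IsSmoothForm Ξ)
    {γ : MForm 𝓘(ℝ, EM) M ℂ l} (hγ : IsSmoothForm γ) (hγc : IsClosedForm γ) :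
    ∃ G' : P →L[ℝ] ℂ,
      HasFDerivAt (fun p ↦ cintegral o ((γ.wedge (Ξ.pullback 𝓘(ℝ, EM) (Ψ p))).castDeg hkl))
        G' t ∧
      ∀ h, G' h = cintegral o ((γ.wedge (fun x ↦
          letI b : ET [⋀^Fin (k + 1 + 1)]→L[ℝ] ℂ := mextDeriv Ξ (Ψ t x);
          (b.curryLeft (mfderiv 𝓘(ℝ, P) IT (fun p ↦ Ψ p x) t h)).compContinuousLinearMap
            (mfderiv 𝓘(ℝ, EM) IT (Ψ t) x))).castDeg hkl) := by
  subst hkl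
  haveI : WedgeFacts 𝓘(ℝ, EM) M ℂ := wedgeFacts_discharged _ _ ℂ
  -- the family is smooth near every point of `U × M`
  have hΨev : ∀ p ∈ U, ∀ x, ∀ᶠ q in 𝓝 (p, x),
      ContMDiffAt (𝓘(ℝ, P).prod 𝓘(ℝ, EM)) IT ∞ (uncurry Ψ) q := by
    intro p hp x
    have h1 : ∀ᶠ q : P × M in 𝓝 (p, x), q.1 ∈ U :=
      continuousAt_fst.preimage_mem_nhds (hU.mem_nhds hp)
    exact h1.mono fun q hq ↦ hΨ q.1 hq q.2
  -- the contraction forms `η h = Ψ_t^*(ι_{Y_h} Ξ)`, `A h = Ψ_t^*(ι_{Y_h} dΞ)`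
  set η : P → MForm 𝓘(ℝ, EM) M ℂ k := fun h x ↦
    letI b : ET [⋀^Fin (k + 1)]→L[ℝ] ℂ := Ξ (Ψ t x);
    (b.curryLeft (mfderiv 𝓘(ℝ, P) IT (fun p ↦ Ψ p x) t h)).compContinuousLinearMap
      (mfderiv 𝓘(ℝ, EM) IT (Ψ t) x) with hη
  set A : P → MForm 𝓘(ℝ, EM) M ℂ (k + 1) := fun h x ↦
    letI b : ET [⋀^Fin (k + 1 + 1)]→L[ℝ] ℂ := mextDeriv Ξ (Ψ t x);
    (b.curryLeft (mfderiv 𝓘(ℝ, P) IT (fun p ↦ Ψ p x) t h)).compContinuousLinearMap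
      (mfderiv 𝓘(ℝ, EM) IT (Ψ t) x) with hA
  have hηs : ∀ h, IsSmoothForm (η h) := fun h x ↦
    smoothAt_contraction_family (I := 𝓘(ℝ, EM)) (I' := IT) hΞ h (hΨev t ht x)
  have hdΞ : IsSmoothForm (mextDeriv Ξ) := isSmoothForm_mextDeriv (inChart_mextDeriv_holds _ _ _) hΞ
  have hAs : ∀ h, IsSmoothForm (A h) := fun h x ↦
    smoothAt_contraction_family (I := 𝓘(ℝ, EM)) (I' := IT) hdΞ h (hΨev t ht x)
  -- pointwise derivative of `p ↦ (Ψ_p^*Ξ)(x)`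
  have hD := fun x ↦ hasFDerivAt_pullback_family (I := 𝓘(ℝ, EM)) (I' := IT) hΞ (x := x)
    (hΨev t ht x)
  choose L hL hL' using hD
  -- the family of top forms `F p = γ ∧ Ψ_p^*Ξ` and its pointwise derivative
  set F : P → MForm 𝓘(ℝ, EM) M ℂ (l + (k + 1)) := fun p ↦ γ.wedge (Ξ.pullback 𝓘(ℝ, EM) (Ψ p))
    with hF
  set W : M → (EM [⋀^Fin (k + 1)]→L[ℝ] ℂ) →L[ℝ] (EM [⋀^Fin (l + (k + 1))]→L[ℝ] ℂ) := fun x ↦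
    letI c : EM [⋀^Fin l]→L[ℝ] ℂ := γ x; wedgeCLM ℝ EM ℂ l (k + 1) c with hW
  have hFx : ∀ x, HasFDerivAt (fun p ↦ (F p x : EM [⋀^Fin (l + (k + 1))]→L[ℝ] ℂ))
      ((W x).comp (L x)) t := fun x ↦ by
    have h1 := (W x).hasFDerivAt.comp t (hL x)
    exact h1
  -- real and imaginary parts
  set reL : (EM [⋀^Fin (l + (k + 1))]→L[ℝ] ℂ) →L[ℝ] (EM [⋀^Fin (l + (k + 1))]→L[ℝ] ℝ) :=
    ContinuousLinearMap.compContinuousAlternatingMapCLM ℝ EM ℂ ℝ (Fin (l + (k + 1))) Complex.reCLM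
    with hreL
  set imL : (EM [⋀^Fin (l + (k + 1))]→L[ℝ] ℂ) →L[ℝ] (EM [⋀^Fin (l + (k + 1))]→L[ℝ] ℝ) :=
    ContinuousLinearMap.compContinuousAlternatingMapCLM ℝ EM ℂ ℝ (Fin (l + (k + 1))) Complex.imCLM
    with himL
  have hFre : ∀ x, HasFDerivAt (fun p ↦ ((F p).re x : EM [⋀^Fin (l + (k + 1))]→L[ℝ] ℝ))
      (reL.comp ((W x).comp (L x))) t := fun x ↦ by
    have h1 := reL.hasFDerivAt.comp t (hFx x)
    exact h1
  have hFim : ∀ x, HasFDerivAt (fun p ↦ ((F p).im x : EM [⋀^Fin (l + (k + 1))]→L[ℝ] ℝ))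
      (imL.comp ((W x).comp (L x))) t := fun x ↦ by
    have h1 := imL.hasFDerivAt.comp t (hFx x)
    exact h1
  -- chart-wise joint smoothness of the family of representatives
  have hFsm : ∀ i, ∀ q ∈ U ×ˢ (extChartAt 𝓘(ℝ, EM) i).target,
      ContDiffAt ℝ ∞ (fun q' : P × EM ↦ (F q'.1).inChart i q'.2) q := by
    intro i q hq
    have h1 : ContDiffAt ℝ ∞ (fun q' : P × EM ↦ (Ξ.pullback 𝓘(ℝ, EM) (Ψ q'.1)).inChart i q'.2) q :=
      contDiffAt_inChart_pullback_family hΞ hq.2 (hΨev q.1 hq.1 _)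
    have h2 : ContDiffAt ℝ ∞ (fun q' : P × EM ↦ γ.inChart i q'.2) q := by
      have hz : (extChartAt 𝓘(ℝ, EM) i).symm q.2 ∈ (extChartAt 𝓘(ℝ, EM) i).source :=
        (extChartAt 𝓘(ℝ, EM) i).map_target hq.2
      have h3 := MForm.SmoothAt.contDiffWithinAt_inChart hz (hγ _)
      rw [(extChartAt 𝓘(ℝ, EM) i).right_inv hq.2, ModelWithCorners.Boundaryless.range_eq_univ,
        contDiffWithinAt_univ] at h3
      exact h3.comp q contDiffAt_snd
    have hfun : (fun q' : P × EM ↦ (F q'.1).inChart i q'.2) =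
        fun q' ↦ (γ.inChart i q'.2).wedge ((Ξ.pullback 𝓘(ℝ, EM) (Ψ q'.1)).inChart i q'.2) := by
      funext q'
      rw [hF]
      simp only [inChart_wedge]
    rw [hfun]
    exact (h2.contDiffWithinAt.wedge h1.contDiffWithinAt).contDiffAt univ_mem
  have hFre_sm : ∀ i, ContDiffOn ℝ 1
      (fun q : P × EM ↦ ((F q.1).re).inChart i q.2 (modelBasis EM (l + (k + 1))))
      (U ×ˢ (extChartAt 𝓘(ℝ, EM) i).target) := by
    intro i q hq
    have h := ((hFsm i q hq).continuousAlternatingMap_apply_const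
      (modelBasis EM (l + (k + 1)))).contDiffWithinAt (s := U ×ˢ (extChartAt 𝓘(ℝ, EM) i).target)
    have h' := (Complex.reCLM.contDiff.of_le le_top).comp_contDiffWithinAt h
    exact (h'.of_le (WithTop.coe_le_coe.2 le_top)).congr (fun q' _ ↦ rfl) rfl
  have hFim_sm : ∀ i, ContDiffOn ℝ 1
      (fun q : P × EM ↦ ((F q.1).im).inChart i q.2 (modelBasis EM (l + (k + 1))))
      (U ×ˢ (extChartAt 𝓘(ℝ, EM) i).target) := by
    intro i q hq
    have h := ((hFsm i q hq).continuousAlternatingMap_apply_const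
      (modelBasis EM (l + (k + 1)))).contDiffWithinAt (s := U ×ˢ (extChartAt 𝓘(ℝ, EM) i).target)
    have h' := (Complex.imCLM.contDiff.of_le le_top).comp_contDiffWithinAt h
    exact (h'.of_le (WithTop.coe_le_coe.2 le_top)).congr (fun q' _ ↦ rfl) rfl
  -- differentiation under the integral sign, for the real and imaginary parts
  obtain ⟨Lre, hLre, hLre'⟩ := hasFDerivAt_integral_of_contDiffOn_of_hasFDerivAt ho
    (fun p ↦ (F p).re) hU ht hFre_sm hFre
  obtain ⟨Lim, hLim, hLim'⟩ := hasFDerivAt_integral_of_contDiffOn_of_hasFDerivAt ho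
    (fun p ↦ (F p).im) hU ht hFim_sm hFim
  -- the derivative form `D h = γ ∧ (dη_h + A_h)` and its real / imaginary parts
  have hDre : ∀ h, (fun x ↦ (reL.comp ((W x).comp (L x))) h : MForm 𝓘(ℝ, EM) M ℝ (l + (k + 1))) =
      (γ.wedge (mextDeriv (η h) + A h)).re := by
    intro h
    funext x
    change Complex.reCLM.compContinuousAlternatingMap ((W x) (L x h)) = _
    rw [hL' x h]
    rfl
  have hDim : ∀ h, (fun x ↦ (imL.comp ((W x).comp (L x))) h : MForm 𝓘(ℝ, EM) M ℝ (l + (k + 1))) =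
      (γ.wedge (mextDeriv (η h) + A h)).im := by
    intro h
    funext x
    change Complex.imCLM.compContinuousAlternatingMap ((W x) (L x h)) = _
    rw [hL' x h]
    rfl
  -- assemble
  refine ⟨Complex.ofRealCLM.comp Lre + Complex.I • Complex.ofRealCLM.comp Lim, ?_, fun h ↦ ?_⟩
  · have h1 : HasFDerivAt (fun p ↦ ((MForm.integral o (F p).re : ℝ) : ℂ))
        (Complex.ofRealCLM.comp Lre) t := Complex.ofRealCLM.hasFDerivAt.comp t hLre
    have h2 : HasFDerivAt (fun p ↦ Complex.I * ((MForm.integral o (F p).im : ℝ) : ℂ))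
        (Complex.I • Complex.ofRealCLM.comp Lim) t :=
      (Complex.ofRealCLM.hasFDerivAt.comp t hLim).const_mul Complex.I
    exact h1.add h2
  · have hsD : IsSmoothForm (mextDeriv (η h)) := isSmoothForm_mextDeriv (inChart_mextDeriv_holds _ _ _) (hηs h)
    have hw1 : IsSmoothForm (γ.wedge (mextDeriv (η h))) := isSmoothForm_wedge hγ hsD
    have hw2 : IsSmoothForm (γ.wedge (A h)) := isSmoothForm_wedge hγ (hAs h)
    have h0 := cintegral_wedge_mextDeriv_eq_zero (o := o) ho rfl hγ hγc (hηs h)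
    rw [MForm.castDeg_rfl] at h0
    calc (Complex.ofRealCLM.comp Lre + Complex.I • Complex.ofRealCLM.comp Lim) h
        = cintegral o (γ.wedge (mextDeriv (η h) + A h)) := by
          change Complex.ofRealCLM (Lre h) + Complex.I • Complex.ofRealCLM (Lim h) = _
          rw [hLre' h, hLim' h, hDre h, hDim h, Complex.ofRealCLM_apply, Complex.ofRealCLM_apply,
            smul_eq_mul]
          rfl
      _ = cintegral o (γ.wedge (mextDeriv (η h))) + cintegral o (γ.wedge (A h)) := by
          rw [MForm.wedge_add_right, HodgeRiemannDegreeOne.cintegral_add' o ho hw1 hw2]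
      _ = cintegral o (γ.wedge (A h)) := by rw [h0, zero_add]

end Literature.AlgebraicGeometry.HodgeTheory
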